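import Summits.Ventures.LatticeQCDFlow.Exactness.HeatBathSweepErgodic
import HarnessLib

/-!
# Locality of the site heat bath: it reads only the factors through its site, and heat baths at non-interacting sites commute

HONEST FRAMING: exact (Metropolis-corrected) sampling algorithms for lattice gauge theory;
figures of merit are autocorrelation/cost numbers at stated couplings and volumes; no
continuum-physics claim.

Venture `LatticeQCDFlow` (cell pub-lqcd), topic `Exactness`, FANOUT row 9 (eng-latcore, the
engine `latflow.core`).  NEW WORK of the cell over row 9's `RefreshScan.lean` (`siteLift`) and
`HeatBathSweepErgodic.lean` (`siteHeatBath`), Mathlib Tonelli.  Nothing is cited as a fact.  Printed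
counterpart, NAMED ONLY: the chequerboard / multi-colour decomposition of local updates (e.g.
Barkai–Moriarty 1982; the engine's 16-colour block scheme of acceptance test A9).

The engine updates all links of one colour class "at once" (threads), a class being a set of links
no two of which share a plaquette.  Why this is the same Markov kernel as the serial sweep:
(1) the heat bath at a link only reads the Boltzmann factors through that link (its staples) —
every other factor CANCELS between numerator and normaliser; (2) two site updates that do not read
each other's coordinate COMMUTE (and their composition is the independent joint update).

## What is proved (`Ω = Π_i X_i`, probability references `μ_i`)

* "`f` does not read coordinate `j`" is spelled `∀ ω ζ, f (update ω j ζ) = f ω` throughout.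
* **`siteLift_comm`** — for s-finite site laws `κ` at `i` and `η` at `j ≠ i` with
  `κ (update ω j ζ) = κ ω` and `η (update ω i ξ) = η ω`:
  `siteLift i κ ∘ₖ siteLift j η = siteLift j η ∘ₖ siteLift i κ` (Tonelli + `update_comm`).
* **`siteHeatBathLaw_mul_of_indepOf`** — LOCALITY: if `G` does not read site `i` and
  `0 < G < ∞`, then `siteHeatBathLaw μ (F * G) i = siteHeatBathLaw μ F i` (hence the same for
  `siteHeatBath`): the link heat bath sees only its staples.
* `siteHeatBathLaw_update_of_indepOf` — if `F` does not read site `j ≠ i`, the heat-bath law at `i`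
  does not read `ω_j`.
* **`siteHeatBath_comm`** — if `p = F * G` with `F` not reading `j`, `G` not reading `i`
  (`i ≠ j`; measurable, `0 < F, G < ∞`, finite non-zero normalisers), then
  `siteHeatBath μ p i ∘ₖ siteHeatBath μ p j = siteHeatBath μ p j ∘ₖ siteHeatBath μ p i` — links of
  one colour class may be heat-bathed in any order (or concurrently with independent randomness).

NOT CLAIMED: anything about shared random streams / floating point (A9 checks the bytes); the
over-relaxation analogue (deterministic, `ClassSweep.lean` covers commuting deterministic updates).
-/

namespace Summit.Ventures.LatticeQCDFlow.Exactness

open MeasureTheory ProbabilityTheory Function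
open scoped ENNReal

section Locality

variable {ι : Type*} [DecidableEq ι] {X : ι → Type*} [∀ i, MeasurableSpace (X i)]

/-- **Site updates that do not read each other's coordinate commute.** -/
theorem siteLift_comm {i j : ι} (hij : i ≠ j) (κ : Kernel (Π k, X k) (X i)) (η : Kernel (Π k, X k) (X j))
    [IsSFiniteKernel κ] [IsSFiniteKernel η] (hκ : ∀ ω (ζ : X j), κ (update ω j ζ) = κ ω)
    (hη : ∀ ω (ξ : X i), η (update ω i ξ) = η ω) :
    siteLift i κ ∘ₖ siteLift j η = siteLift j η ∘ₖ siteLift i κ := by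
  ext ω : 1
  refine Measure.ext_of_lintegral _ fun g hg => ?_
  have hgi : Measurable (uncurry fun (ω' : Π k, X k) (ξ : X i) => g (update ω' i ξ)) :=
    hg.comp measurable_update'
  have hgj : Measurable (uncurry fun (ω' : Π k, X k) (ζ : X j) => g (update ω' j ζ)) :=
    hg.comp measurable_update'
  rw [Kernel.lintegral_comp _ _ _ hg, Kernel.lintegral_comp _ _ _ hg]
  simp_rw [lintegral_siteLift _ _ _ hg]
  rw [lintegral_siteLift _ _ _ hgi.lintegral_kernel_prod_right,
    lintegral_siteLift _ _ _ hgj.lintegral_kernel_prod_right]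
  simp_rw [hκ, hη, Function.update_comm (Ne.symm hij)]
  have hmeas : Measurable (uncurry fun (ζ : X j) (ξ : X i) => g (update (update ω i ξ) j ζ)) :=
    hg.comp (measurable_update'.comp (((measurable_update ω).comp measurable_snd).prodMk measurable_fst))
  exact lintegral_lintegral_swap hmeas.aemeasurable

variable {μ : Π i, Measure (X i)} [∀ i, IsProbabilityMeasure (μ i)]

omit [∀ i, IsProbabilityMeasure (μ i)] in
/-- A factor that does not read site `i` multiplies the conditional normaliser at `i`. -/
theorem siteNorm_mul_of_indepOf {F G : (Π k, X k) → ℝ≥0∞} (hF : Measurable F) {i : ι}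
    (hGi : ∀ ω (ξ : X i), G (update ω i ξ) = G ω) (ω : Π k, X k) : siteNorm μ (F * G) i ω = siteNorm μ F i ω * G ω := by
  rw [siteNorm_eq, siteNorm_eq]
  have h : ∀ ξ, (F * G) (update ω i ξ) = F (update ω i ξ) * G ω := fun ξ => by
    rw [Pi.mul_apply, hGi]
  simp_rw [h]
  exact lintegral_mul_const _ (hF.comp (measurable_update ω))

/-- **Locality of the heat bath**: a factor of the density that does not read site `i` (and is
neither `0` nor `∞`) cancels — the heat-bath law at `i` only sees the factors through `i`
(for the Wilson weight: the plaquettes containing the link, i.e. its staples). -/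
theorem siteHeatBathLaw_mul_of_indepOf {F G : (Π k, X k) → ℝ≥0∞} (hF : Measurable F) {i : ι}
    (hGi : ∀ ω (ξ : X i), G (update ω i ξ) = G ω) (hG0 : ∀ ω, G ω ≠ 0) (hGtop : ∀ ω, G ω ≠ ∞) :
    siteHeatBathLaw μ (F * G) i = siteHeatBathLaw μ F i := by
  unfold siteHeatBathLaw
  congr 1
  funext ω ξ
  rw [siteNorm_mul_of_indepOf hF hGi, Pi.mul_apply, hGi,
    ENNReal.mul_inv (Or.inr (hGtop ω)) (Or.inr (hG0 ω)), mul_mul_mul_comm,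
    ENNReal.mul_inv_cancel (hG0 ω) (hGtop ω), mul_one]

/-- The same for the lifted kernel. -/
theorem siteHeatBath_mul_of_indepOf {F G : (Π k, X k) → ℝ≥0∞} (hF : Measurable F) {i : ι}
    (hGi : ∀ ω (ξ : X i), G (update ω i ξ) = G ω) (hG0 : ∀ ω, G ω ≠ 0) (hGtop : ∀ ω, G ω ≠ ∞) :
    siteHeatBath μ (F * G) i = siteHeatBath μ F i := by
  rw [siteHeatBath, siteHeatBath, siteHeatBathLaw_mul_of_indepOf hF hGi hG0 hGtop]

/-- If the density does not read site `j ≠ i`, neither does the heat-bath law at `i`. -/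
theorem siteHeatBathLaw_update_of_indepOf {F : (Π k, X k) → ℝ≥0∞} (hF : Measurable F) {i j : ι}
    (hij : i ≠ j) (hFj : ∀ ω (ζ : X j), F (update ω j ζ) = F ω) (ω : Π k, X k) (ζ : X j) :
    siteHeatBathLaw μ F i (update ω j ζ) = siteHeatBathLaw μ F i ω := by
  rw [siteHeatBathLaw, Kernel.withDensity_apply _ (measurable_siteHeatBathDensity hF i),
    Kernel.withDensity_apply _ (measurable_siteHeatBathDensity hF i), Kernel.const_apply, Kernel.const_apply]
  congr 1
  funext ξ
  have hZ : siteNorm μ F i (update ω j ζ) = siteNorm μ F i ω := by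
    rw [siteNorm_eq, siteNorm_eq]
    refine lintegral_congr fun ξ' => ?_
    rw [Function.update_comm (Ne.symm hij), hFj]
  rw [hZ, Function.update_comm (Ne.symm hij), hFj]

/-- A positive measurable factor has a non-vanishing conditional normaliser (probability `μ_i`). -/
theorem siteNorm_ne_zero_of_ne_zero {F : (Π k, X k) → ℝ≥0∞} (hF : Measurable F) (hF0 : ∀ ω, F ω ≠ 0)
    (i : ι) (ω : Π k, X k) : siteNorm μ F i ω ≠ 0 := by
  rw [siteNorm_eq]
  intro h
  have hm : Measurable fun ξ : X i => F (update ω i ξ) := hF.comp (measurable_update ω)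
  rw [lintegral_eq_zero_iff hm] at h
  haveI : (ae (μ i)).NeBot := ae_neBot.2 (IsProbabilityMeasure.ne_zero (μ i))
  obtain ⟨ξ, hξ⟩ := h.exists
  exact hF0 _ hξ

/-- **Heat baths at non-interacting sites commute.**  If the density factors as `p = F * G` with
`F` not reading site `j` and `G` not reading site `i` (`i ≠ j`; both measurable with values in
`(0, ∞)`), the two site heat baths commute:
`K_i ∘ₖ K_j = K_j ∘ₖ K_i` — links of one colour class may be updated in any order. -/
theorem siteHeatBath_comm {F G : (Π k, X k) → ℝ≥0∞} (hF : Measurable F) (hG : Measurable G) {i j : ι}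
    (hij : i ≠ j) (hFj : ∀ ω (ζ : X j), F (update ω j ζ) = F ω) (hGi : ∀ ω (ξ : X i), G (update ω i ξ) = G ω)
    (hF0 : ∀ ω, F ω ≠ 0) (hFtop : ∀ ω, F ω ≠ ∞)
    (hG0 : ∀ ω, G ω ≠ 0) (hGtop : ∀ ω, G ω ≠ ∞) :
    siteHeatBath μ (F * G) i ∘ₖ siteHeatBath μ (F * G) j =
      siteHeatBath μ (F * G) j ∘ₖ siteHeatBath μ (F * G) i := by
  have hGF : G * F = F * G := mul_comm G F
  rw [siteHeatBath_mul_of_indepOf hF hGi hG0 hGtop, ← hGF, siteHeatBath_mul_of_indepOf hG hFj hF0 hFtop]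
  haveI := isSFiniteKernel_siteHeatBathLaw (μ := μ) hFtop (siteNorm_ne_zero_of_ne_zero hF hF0 i)
  haveI := isSFiniteKernel_siteHeatBathLaw (μ := μ) hGtop (siteNorm_ne_zero_of_ne_zero hG hG0 j)
  exact siteLift_comm hij _ _ (siteHeatBathLaw_update_of_indepOf hF hij hFj)
    (siteHeatBathLaw_update_of_indepOf hG (Ne.symm hij) hGi)

end Locality

end Summit.Ventures.LatticeQCDFlow.Exactness
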